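import Literature.Analysis.SegalBargmann.FockPolynomialWeights
import Literature.RepresentationTheory.Ichino2022.ExplicitLineModel
import HarnessLib

/-!
# Junction: the polynomial-side weights of the explicit Fock model `ℂ[z₁, z₂, w]` are the `K × K′`-torus weights of ANY Heisenberg-covariant realisation (Folland 1989, Prop. (4.39); Ichino 2022, Lemma 7.10)

Topic `Analysis/SegalBargmann`; namespace `Literature.Analysis.SegalBargmann`.  This file joins two kernel
developments of the tree:

* the ANALYTIC side `Literature.Analysis.SegalBargmann.FockPolynomialWeights` (over
  `…FockWeightSpaces`, `…FockDualPairCompact`, `…SchrodingerCompactRigidity`): for any family `ω` of unitaries of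
  `L²(ℝ^𝕀)` that is Heisenberg-covariant over the block datum `dualPairι` of a compact dual pair
  `(U(P)×U(Q)) × (U(R)×U(S))` (`IsRhoCovariant`), a polynomial `F` is weighted-homogeneous for a weight vector
  `w` iff `B⁻¹ F` is a weight vector of the corresponding one-parameter torus, with weight
  `vacCoeff · u^n` (`IsRhoCovariant.apply_bargmannSymm_fockToL2_of_isWeightedHomogeneous`,
  `…isWeightedHomogeneous_of_weightVector`);
* the ALGEBRAIC side `Literature.RepresentationTheory.Ichino2022.ExplicitLineModel` (A. Ichino, Adv. Math. 398
  (2022) Lemma 7.10 PROVED in the explicit model `ℂ[z₁,z₂,w]` of `(U(2,1), U(1))`, weights `uW`, `rowW a`, `wDeg`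
  as `MvPolynomial.IsWeightedHomogeneous`).

Contents (everything PROVED; no cited fact is used):

* §1 transport of weighted homogeneity along a renaming equivalence (`weight_mapDomain_equiv`,
  `isWeightedHomogeneous_rename_iff`) and under negation of the weight vector (`isWeightedHomogeneous_neg_iff`);
* §2 for a general compact dual pair: the one-coordinate tori `κP t = ((diagHom t, 1), (1, 1))`,
  `κQ t = ((1, diagHom t), (1, 1))` of `U(P) × U(Q)`, their block data (`dualPairι_κP`, `dualPairι_κQ`), the
  signed coordinate weights `wtP a`, `wtQ b : DPIdx P Q R S → ℤ` with `dualPairι (κP (single a u)) = diagHom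
  (u ^ (− wtP a))` (`dualPairι_κP_single`, `dualPairι_κQ_single`), and the weight-vector criteria
  `IsRhoCovariant.isWeightedHomogeneous_wtP_iff / _wtQ_iff` (companions of T7's `…_blockSignW_iff`);
* §3 the signature `(p,q;r,s) = (2,1;1,0)` of [Ich22] §7.5 (`V = (2,1)` indexes `(P,Q) = (Fin 2, Unit)`,
  `W = (1,0)` indexes `(R,S) = (Unit, Empty)`): the index equivalence
  `varEquiv : ExplicitLine.Var ≃ DPIdx (Fin 2) Unit Unit Empty` (`z_a ↦ V⁺⊗W⁺`-coordinate `a`, `w ↦` the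
  `V⁻⊗W⁺`-coordinate) with `blockSignW ∘ varEquiv = uW`, `wtP a ∘ varEquiv = rowW a`,
  `wtQ () ∘ varEquiv = −wDeg` (`blockSignW_varEquiv`, `wtP_varEquiv`, `wtQ_varEquiv`);
* §4 **the junction theorems**: for `F : ExplicitLine.Model` and `f := B⁻¹ (rename varEquiv F) ∈ L²(ℝ³)`,
  `IsWeightedHomogeneous uW F k ↔ (U(W) acts on f by vacCoeff · u^k)` (`uW_iff`),
  `IsWeightedHomogeneous (rowW a) F n ↔ (the a-th coordinate circle of U(2)_V acts by vacCoeff · u^n)`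
  (`rowW_iff`), `IsWeightedHomogeneous wDeg F e ↔ (U(1)_{V⁻} acts by vacCoeff · u^{−e})` (`wDeg_iff`);
  hence the weight clauses of `ExplicitLine.IsHWVector F k n₁ n₂ e` give the four torus eigen-equations of `f`
  for ANY covariant realisation (`torusWeights_of_isHWVector`), and `f ≠ 0` (`transfer_ne_zero`).

What this does NOT cover (infinitesimal, not torus-level): harmonicity (`Δ_a F = 0`, the `𝔭′⁻`-operators) and the
highest-weight condition `E₊ F = 0`; those are statements about the differentiated action.

Use (pub-hodgecm model cell, W3-B ↔ W3-K junction): the `weight` field of the D5-arch supply (the `U(W)(ℝ) =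
U(1)`-weight of `φ_∞ := B⁻¹(z₁^a)` or `B⁻¹(w^d)`) is, for the CONSTRUCTED archimedean Weil representation restricted
to `K × K′` (which is Heisenberg-covariant over `dualPairι`), the printed weight `u^{k}` times the vacuum character
`vacChar` — the only datum left to a construction or a citation ([Ich22] §4.1 shifts `m₀, n₀`).

## References

* [Folland1989] G. B. Folland, *Harmonic Analysis in Phase Space*, Princeton University Press, 1989, (1.78) p. 41,
  Prop. (4.39) p. 161 (doi:10.1515/9781400882427).
  Locators: equation / proposition NUMBERS are the printed ones; "p. N" is the page index of the held digitisation
  `book:folland1989-harmonic-analysis-phase-space` (file `pNNNN`), on which every quoted item was read.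
* [Ichino2022ThetaReal] A. Ichino, *Theta lifting for tempered representations of real unitary groups*, Adv. Math.
  398 (2022) 108188, §4.1, §7.5 Lemma 7.10.
-/

noncomputable section

open MeasureTheory Complex Matrix MvPolynomial
open scoped InnerProductSpace ComplexConjugate

namespace Literature.Analysis.SegalBargmann

local notation "L2R" σ => Lp ℂ 2 (volume : Measure (σ → ℝ))

/-! ## 1. Weighted homogeneity under renaming and negation -/

section Rename

variable {σ τ : Type*}

/-- `weight w (mapDomain e d) = weight (w ∘ e) d` for an injective renaming. [folklore] -/
theorem weight_mapDomain_of_injective (e : σ → τ) (he : Function.Injective e) (w : τ → ℤ) (d : σ →₀ ℕ) :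
    Finsupp.weight w (Finsupp.mapDomain e d) = Finsupp.weight (w ∘ e) d := by
  simp only [Finsupp.weight_apply]
  rw [Finsupp.sum_mapDomain_index_inj he]
  rfl

/-- **Weighted homogeneity transports along a renaming equivalence**:
`IsWeightedHomogeneous w (rename e F) n ↔ IsWeightedHomogeneous (w ∘ e) F n`. [folklore] -/
theorem isWeightedHomogeneous_rename_iff (e : σ ≃ τ) (w : τ → ℤ) (F : MvPolynomial σ ℂ) (n : ℤ) :
    IsWeightedHomogeneous w (rename e F) n ↔ IsWeightedHomogeneous (w ∘ e) F n := by
  constructor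
  · intro hF d hd
    have h1 : coeff (Finsupp.mapDomain e d) (rename e F) ≠ 0 := by
      rwa [coeff_rename_mapDomain e e.injective]
    have h2 := hF h1
    rwa [weight_mapDomain_of_injective e e.injective] at h2
  · intro hF d' hd'
    have hd'eq : d' = Finsupp.mapDomain e (Finsupp.mapDomain e.symm d') := by
      rw [← Finsupp.mapDomain_comp, Equiv.self_comp_symm, Finsupp.mapDomain_id]
    rw [hd'eq, coeff_rename_mapDomain e e.injective] at hd'
    rw [hd'eq, weight_mapDomain_of_injective e e.injective]
    exact hF hd'

/-- `weight (−w) d = − weight w d`. [folklore] -/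
theorem weight_neg (w : σ → ℤ) (d : σ →₀ ℕ) : Finsupp.weight (-w) d = -Finsupp.weight w d := by
  simp only [Finsupp.weight_apply, Finsupp.sum, Pi.neg_apply, smul_neg, Finset.sum_neg_distrib]

/-- `IsWeightedHomogeneous (−w) F (−n) ↔ IsWeightedHomogeneous w F n`. [folklore] -/
theorem isWeightedHomogeneous_neg_iff (w : σ → ℤ) (F : MvPolynomial σ ℂ) (n : ℤ) :
    IsWeightedHomogeneous (-w) F (-n) ↔ IsWeightedHomogeneous w F n := by
  constructor
  · intro hF d hd
    have h := hF hd
    rw [weight_neg] at h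
    exact neg_injective h
  · intro hF d hd
    rw [weight_neg, hF hd]

end Rename

/-! ## 2. One-coordinate tori of `U(P) × U(Q)` in a compact dual pair -/

section DualPair

variable {P Q R S : Type*} [Fintype P] [DecidableEq P] [Fintype Q] [DecidableEq Q] [Fintype R] [DecidableEq R]
  [Fintype S] [DecidableEq S]

/-- The torus of the first factor `U(P)` inside `K × K′`: `((diagHom t, 1), (1, 1))`. [folklore] -/
def κP (t : P → Circle) : DPK P Q R S := ((diagHom t, 1), (1, 1))

/-- The torus of the second factor `U(Q)` inside `K × K′`: `((1, diagHom t), (1, 1))`. [folklore] -/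
def κQ (t : Q → Circle) : DPK P Q R S := ((1, diagHom t), (1, 1))

/-- Block datum of `κP t`: the diagonal torus `dpTorus t 1 1 1`. [folklore] -/
theorem dualPairι_κP (t : P → Circle) :
    dualPairι (κP (Q := Q) (R := R) (S := S) t) =
      diagHom (dpTorus t (fun _ : Q => (1 : Circle)) (fun _ : R => (1 : Circle)) (fun _ : S => (1 : Circle))) := by
  have h := dualPairι_diagHom t (fun _ : Q => (1 : Circle)) (fun _ : R => (1 : Circle)) (fun _ : S => (1 : Circle))
  rwa [show diagHom (fun _ : Q => (1 : Circle)) = 1 from map_one diagHom,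
    show diagHom (fun _ : R => (1 : Circle)) = 1 from map_one diagHom,
    show diagHom (fun _ : S => (1 : Circle)) = 1 from map_one diagHom] at h

/-- Block datum of `κQ t`: the diagonal torus `dpTorus 1 t 1 1`. [folklore] -/
theorem dualPairι_κQ (t : Q → Circle) :
    dualPairι (κQ (P := P) (R := R) (S := S) t) =
      diagHom (dpTorus (fun _ : P => (1 : Circle)) t (fun _ : R => (1 : Circle)) (fun _ : S => (1 : Circle))) := by
  have h := dualPairι_diagHom (fun _ : P => (1 : Circle)) t (fun _ : R => (1 : Circle)) (fun _ : S => (1 : Circle))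
  rwa [show diagHom (fun _ : P => (1 : Circle)) = 1 from map_one diagHom,
    show diagHom (fun _ : R => (1 : Circle)) = 1 from map_one diagHom,
    show diagHom (fun _ : S => (1 : Circle)) = 1 from map_one diagHom] at h

/-- **Signed weight of the `a`-th coordinate of `U(P)`** on the complex coordinates of `𝕎`: `+1` on the
`V⁺⊗W⁺`-coordinates `(a, r)` (conjugated block), `−1` on the `V⁺⊗W⁻`-coordinates `(a, s)`, `0` elsewhere.
[folklore] -/
def wtP (a : P) : DPIdx P Q R S → ℤ
  | Sum.inl (Sum.inl pr) => if pr.1 = a then 1 else 0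
  | Sum.inl (Sum.inr _) => 0
  | Sum.inr (Sum.inl ps) => if ps.1 = a then -1 else 0
  | Sum.inr (Sum.inr _) => 0

/-- **Signed weight of the `b`-th coordinate of `U(Q)`**: `+1` on `V⁻⊗W⁻`-coordinates `(b, s)`, `−1` on
`V⁻⊗W⁺`-coordinates `(b, r)`, `0` elsewhere. [folklore] -/
def wtQ (b : Q) : DPIdx P Q R S → ℤ
  | Sum.inl (Sum.inl _) => 0
  | Sum.inl (Sum.inr qs) => if qs.1 = b then 1 else 0
  | Sum.inr (Sum.inl _) => 0
  | Sum.inr (Sum.inr qr) => if qr.1 = b then -1 else 0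

/-- The one-parameter circle in the `a`-th coordinate: `u` at `a`, `1` elsewhere. [folklore] -/
def single (a : P) (u : Circle) : P → Circle := Function.update (fun _ => 1) a u

omit [Fintype P] [Fintype Q] [DecidableEq Q] [Fintype R] [DecidableEq R] [Fintype S] [DecidableEq S] in
/-- `dpTorus (single a u) 1 1 1 = u ^ (− wtP a)`. [folklore] -/
theorem dpTorus_single_P (a : P) (u : Circle) :
    dpTorus (single a u) (fun _ : Q => (1 : Circle)) (fun _ : R => (1 : Circle)) (fun _ : S => (1 : Circle)) =
      fun l => u ^ (-(wtP (Q := Q) (R := R) (S := S) a l)) := by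
  funext l
  rcases l with ((⟨p, r⟩ | ⟨q, s⟩) | (⟨p, s⟩ | ⟨q, r⟩))
  · by_cases hp : p = a
    · subst hp; simp [dpTorus, wtP, single]
    · simp [dpTorus, wtP, single, hp]
  · simp [dpTorus, wtP]
  · by_cases hp : p = a
    · subst hp; simp [dpTorus, wtP, single]
    · simp [dpTorus, wtP, single, hp]
  · simp [dpTorus, wtP]

omit [Fintype P] [DecidableEq P] [Fintype Q] [Fintype R] [DecidableEq R] [Fintype S] [DecidableEq S] in
/-- `dpTorus 1 (single b u) 1 1 = u ^ (− wtQ b)`. [folklore] -/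
theorem dpTorus_single_Q (b : Q) (u : Circle) :
    dpTorus (fun _ : P => (1 : Circle)) (single b u) (fun _ : R => (1 : Circle)) (fun _ : S => (1 : Circle)) =
      fun l => u ^ (-(wtQ (P := P) (R := R) (S := S) b l)) := by
  funext l
  rcases l with ((⟨p, r⟩ | ⟨q, s⟩) | (⟨p, s⟩ | ⟨q, r⟩))
  · simp [dpTorus, wtQ]
  · by_cases hq : q = b
    · subst hq; simp [dpTorus, wtQ, single]
    · simp [dpTorus, wtQ, single, hq]
  · simp [dpTorus, wtQ]
  · by_cases hq : q = b
    · subst hq; simp [dpTorus, wtQ, single]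
    · simp [dpTorus, wtQ, single, hq]

/-- Block datum of the `a`-th coordinate circle of `U(P)`: `diagHom (u ^ (− wtP a))`. [folklore] -/
theorem dualPairι_κP_single (a : P) (u : Circle) :
    dualPairι (κP (Q := Q) (R := R) (S := S) (single a u)) =
      diagHom fun l : DPIdx P Q R S => u ^ (-(wtP a l)) := by
  rw [dualPairι_κP, dpTorus_single_P]

/-- Block datum of the `b`-th coordinate circle of `U(Q)`: `diagHom (u ^ (− wtQ b))`. [folklore] -/
theorem dualPairι_κQ_single (b : Q) (u : Circle) :
    dualPairι (κQ (P := P) (R := R) (S := S) (single b u)) =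
      diagHom fun l : DPIdx P Q R S => u ^ (-(wtQ b l)) := by
  rw [dualPairι_κQ, dpTorus_single_Q]

/-- **Weight-vector criterion for the `U(P)`-coordinate weights** (companion of
`IsRhoCovariant.isWeightedHomogeneous_blockSignW_iff`). [cite: Folland1989, Prop. (4.39) p. 161] -/
theorem IsRhoCovariant.isWeightedHomogeneous_wtP_iff
    {ω : DPK P Q R S → ((L2R (DPIdx P Q R S)) ≃ₗᵢ[ℂ] (L2R (DPIdx P Q R S)))}
    (hω : IsRhoCovariant (fun k => dualPairι k) ω) (a : P) (F : MvPolynomial (DPIdx P Q R S) ℂ) (n : ℤ) :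
    IsWeightedHomogeneous (wtP a) F n ↔
      ∀ u : Circle, ω (κP (single a u)) (bargmann.symm (fockToL2 F)) =
        (vacCoeff ω (κP (single a u)) * ((u : Circle) : ℂ) ^ n) • bargmann.symm (fockToL2 F) :=
  ⟨fun hF u => hω.apply_bargmannSymm_fockToL2_of_isWeightedHomogeneous (dualPairι_κP_single a u) hF,
    fun hF => hω.isWeightedHomogeneous_of_weightVector
      (h := fun u : Circle => κP (Q := Q) (R := R) (S := S) (single a u))
      (fun u => dualPairι_κP_single a u) hF⟩

/-- **Weight-vector criterion for the `U(Q)`-coordinate weights**. [cite: Folland1989, Prop. (4.39) p. 161] -/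
theorem IsRhoCovariant.isWeightedHomogeneous_wtQ_iff
    {ω : DPK P Q R S → ((L2R (DPIdx P Q R S)) ≃ₗᵢ[ℂ] (L2R (DPIdx P Q R S)))}
    (hω : IsRhoCovariant (fun k => dualPairι k) ω) (b : Q) (F : MvPolynomial (DPIdx P Q R S) ℂ) (n : ℤ) :
    IsWeightedHomogeneous (wtQ b) F n ↔
      ∀ u : Circle, ω (κQ (single b u)) (bargmann.symm (fockToL2 F)) =
        (vacCoeff ω (κQ (single b u)) * ((u : Circle) : ℂ) ^ n) • bargmann.symm (fockToL2 F) :=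
  ⟨fun hF u => hω.apply_bargmannSymm_fockToL2_of_isWeightedHomogeneous (dualPairι_κQ_single b u) hF,
    fun hF => hω.isWeightedHomogeneous_of_weightVector
      (h := fun u : Circle => κQ (P := P) (R := R) (S := S) (single b u))
      (fun u => dualPairι_κQ_single b u) hF⟩

end DualPair

/-! ## 3. The signature `(2,1;1,0)`: `ℂ[z₁, z₂, w]` -/

namespace ExplicitLineJunction

open Literature.RepresentationTheory.Ichino2022

/-- Index type of the complex coordinates of `𝕎 = V ⊗ W` for `V = (2,1)`, `W = (1,0)`:
`(P,Q,R,S) = (Fin 2, Unit, Unit, Empty)`. [folklore] -/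
abbrev Idx : Type := DPIdx (Fin 2) Unit Unit Empty

/-- The compact group `K′ × K = (U(2) × U(1)) × (U(1) × U(0))` of this signature. [folklore] -/
abbrev Grp : Type := DPK (Fin 2) Unit Unit Empty

/-- **The index dictionary** `ExplicitLine.Var ≃ Idx`: `z_a ↦` the `V⁺⊗W⁺`-coordinate `(a, ⋆)`,
`w ↦` the `V⁻⊗W⁺`-coordinate `(⋆, ⋆)`. [cite: Ichino2022ThetaReal, §7.5 Lemma 7.10] -/
def varEquiv : ExplicitLine.Var ≃ Idx where
  toFun
    | Sum.inl a => Sum.inl (Sum.inl (a, ()))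
    | Sum.inr _ => Sum.inr (Sum.inr ((), ()))
  invFun
    | Sum.inl (Sum.inl pr) => Sum.inl pr.1
    | Sum.inl (Sum.inr qs) => qs.2.elim
    | Sum.inr (Sum.inl ps) => ps.2.elim
    | Sum.inr (Sum.inr _) => Sum.inr ()
  left_inv v := by rcases v with a | ⟨⟩ <;> rfl
  right_inv l := by
    rcases l with ((⟨p, ⟨⟩⟩ | ⟨q, s⟩) | (⟨p, s⟩ | ⟨⟨⟩, ⟨⟩⟩))
    · rfl
    · exact s.elim
    · exact s.elim
    · rfl

/-- `varEquiv (z_a)`. [folklore] -/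
@[simp] theorem varEquiv_inl (a : Fin 2) : varEquiv (Sum.inl a) = Sum.inl (Sum.inl (a, ())) := rfl
/-- `varEquiv (w)`. [folklore] -/
@[simp] theorem varEquiv_inr (x : Unit) : varEquiv (Sum.inr x) = Sum.inr (Sum.inr ((), ())) := rfl

/-- `blockSignW ∘ varEquiv = uW` (the `U(W)`-weight: `z_a ↦ +1`, `w ↦ −1`). [cite: Ichino2022ThetaReal, §7.5 Lemma 7.10] -/
theorem blockSignW_varEquiv : (blockSignW ∘ varEquiv : ExplicitLine.Var → ℤ) = ExplicitLine.uW := by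
  funext v; rcases v with a | ⟨⟩ <;> rfl

/-- `wtP a ∘ varEquiv = rowW a` (the row weights of the `U(2)_V`-torus). [cite: Ichino2022ThetaReal, §7.5 Lemma 7.10] -/
theorem wtP_varEquiv (a : Fin 2) : (wtP a ∘ varEquiv : ExplicitLine.Var → ℤ) = ExplicitLine.rowW a := by
  funext v
  rcases v with b | ⟨⟩
  · simp only [Function.comp_apply, varEquiv_inl, wtP, ExplicitLine.rowW]
  · rfl

/-- `wtQ ⋆ ∘ varEquiv = − wDeg` (`U(1)_{V⁻}` acts by MINUS the `w`-degree). [cite: Ichino2022ThetaReal, §7.5 Lemma 7.10] -/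
theorem wtQ_varEquiv : (wtQ (P := Fin 2) (R := Unit) (S := Empty) () ∘ varEquiv : ExplicitLine.Var → ℤ) =
    -ExplicitLine.wDeg := by
  funext v; rcases v with a | ⟨⟩ <;> rfl

/-- The transfer of a polynomial of the explicit model to `L²(ℝ^Idx)`: `B⁻¹ (rename varEquiv F)`. [folklore] -/
def transfer (F : ExplicitLine.Model) : L2R Idx := bargmann.symm (fockToL2 (rename varEquiv F))

/-- Unfolding `transfer`. [folklore] -/
theorem transfer_apply (F : ExplicitLine.Model) :
    transfer F = bargmann.symm (fockToL2 (rename varEquiv F)) := rfl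

/-- The transfer is injective; in particular `F ≠ 0 → transfer F ≠ 0`. [folklore] -/
theorem transfer_injective : Function.Injective transfer := fun _ _ h =>
  (rename_injective _ varEquiv.injective) (bargmannSymm_fockToL2_injective h)

/-- `F ≠ 0 → transfer F ≠ 0`. [folklore] -/
theorem transfer_ne_zero {F : ExplicitLine.Model} (hF : F ≠ 0) : transfer F ≠ 0 := by
  intro h
  apply hF
  apply transfer_injective
  rw [h, transfer_apply, map_zero, map_zero, map_zero]

/-! ## 4. The junction theorems -/

variable {ω : Grp → ((L2R Idx) ≃ₗᵢ[ℂ] (L2R Idx))}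

/-- The `U(W) = U(1)` circle `u ↦ ((1,1),(u,·))` of this signature. [folklore] -/
def kW (u : Circle) : Grp := κW ((fun _ : Unit => u), (fun _ : Empty => u))

/-- The `a`-th coordinate circle of the `U(2)_V`-torus. [folklore] -/
def kRow (a : Fin 2) (u : Circle) : Grp := κP (single a u)

/-- The `U(1)_{V⁻}` circle. [folklore] -/
def kCol (u : Circle) : Grp := κQ (single () u)

/-- **Junction (U(W)-weight)**: `F` has `uW`-weight `k` iff `U(W)` acts on `B⁻¹F` by `vacCoeff · u^k`, for ANY
Heisenberg-covariant realisation `ω` over the block datum. [cite: Folland1989, Prop. (4.39) p. 161] -/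
theorem uW_iff (hω : IsRhoCovariant (fun k => dualPairι k) ω) (F : ExplicitLine.Model) (k : ℤ) :
    IsWeightedHomogeneous ExplicitLine.uW F k ↔
      ∀ u : Circle, ω (kW u) (transfer F) = (vacCoeff ω (kW u) * ((u : Circle) : ℂ) ^ k) • transfer F := by
  rw [← blockSignW_varEquiv, ← isWeightedHomogeneous_rename_iff]
  exact hω.isWeightedHomogeneous_blockSignW_iff _ k

/-- **Junction (row weights)**: `F` has `rowW a`-weight `n` iff the `a`-th coordinate circle of `U(2)_V` acts on
`B⁻¹F` by `vacCoeff · u^n`. [cite: Folland1989, Prop. (4.39) p. 161] -/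
theorem rowW_iff (hω : IsRhoCovariant (fun k => dualPairι k) ω) (a : Fin 2) (F : ExplicitLine.Model) (n : ℤ) :
    IsWeightedHomogeneous (ExplicitLine.rowW a) F n ↔
      ∀ u : Circle, ω (kRow a u) (transfer F) =
        (vacCoeff ω (kRow a u) * ((u : Circle) : ℂ) ^ n) • transfer F := by
  rw [← wtP_varEquiv, ← isWeightedHomogeneous_rename_iff]
  exact hω.isWeightedHomogeneous_wtP_iff a _ n

/-- **Junction (`w`-degree)**: `F` has `w`-degree `e` iff `U(1)_{V⁻}` acts on `B⁻¹F` by `vacCoeff · u^{−e}`.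
[cite: Folland1989, Prop. (4.39) p. 161] -/
theorem wDeg_iff (hω : IsRhoCovariant (fun k => dualPairι k) ω) (F : ExplicitLine.Model) (e : ℤ) :
    IsWeightedHomogeneous ExplicitLine.wDeg F e ↔
      ∀ u : Circle, ω (kCol u) (transfer F) =
        (vacCoeff ω (kCol u) * ((u : Circle) : ℂ) ^ (-e)) • transfer F := by
  rw [← isWeightedHomogeneous_neg_iff, ← wtQ_varEquiv, ← isWeightedHomogeneous_rename_iff]
  exact hω.isWeightedHomogeneous_wtQ_iff () _ (-e)

/-- **The torus weights of a joint highest-weight vector of the explicit model**, for any covariant realisation: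
`B⁻¹F ≠ 0` and the circles `U(W)`, `U(2)_V`-coordinates, `U(1)_{V⁻}` act on it by `vacCoeff · u^k`,
`vacCoeff · u^{n_a}`, `vacCoeff · u^{−e}`. [cite: Ichino2022ThetaReal, §7.5 Lemma 7.10] -/
theorem torusWeights_of_isHWVector (hω : IsRhoCovariant (fun k => dualPairι k) ω) {F : ExplicitLine.Model}
    {k n₁ n₂ e : ℤ} (hF : ExplicitLine.IsHWVector F k n₁ n₂ e) :
    transfer F ≠ 0 ∧
      (∀ u : Circle, ω (kW u) (transfer F) = (vacCoeff ω (kW u) * ((u : Circle) : ℂ) ^ k) • transfer F) ∧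
      (∀ u : Circle, ω (kRow 0 u) (transfer F) =
        (vacCoeff ω (kRow 0 u) * ((u : Circle) : ℂ) ^ n₁) • transfer F) ∧
      (∀ u : Circle, ω (kRow 1 u) (transfer F) =
        (vacCoeff ω (kRow 1 u) * ((u : Circle) : ℂ) ^ n₂) • transfer F) ∧
      (∀ u : Circle, ω (kCol u) (transfer F) =
        (vacCoeff ω (kCol u) * ((u : Circle) : ℂ) ^ (-e)) • transfer F) :=
  ⟨transfer_ne_zero hF.ne, (uW_iff hω F k).1 hF.uW, (rowW_iff hω 0 F n₁).1 hF.row0,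
    (rowW_iff hω 1 F n₂).1 hF.row1, (wDeg_iff hω F e).1 hF.wdeg⟩

/-- With the vacuum normalised (`ω 1 = id`, multiplicative, the three hypotheses of `vacChar`): the
`U(W)`-weight of `B⁻¹F` is the CHARACTER `u ↦ vacChar (kW u) · u^k`. [cite: Ichino2022ThetaReal, §7.5 Lemma 7.10] -/
theorem uW_weight_eq_vacChar_mul (hω : IsRhoCovariant (fun k => dualPairι k) ω)
    (hω1 : ∀ f : L2R Idx, ω 1 f = f) (hωm : ∀ (g g' : Grp) (f : L2R Idx), ω (g * g') f = ω g (ω g' f))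
    {F : ExplicitLine.Model} {k : ℤ} (hF : IsWeightedHomogeneous ExplicitLine.uW F k) (u : Circle) :
    ω (kW u) (transfer F) = (((vacChar hω hω1 hωm (kW u) : Circle) : ℂ) * ((u : Circle) : ℂ) ^ k) •
      transfer F := by
  rw [coe_vacChar]
  exact (uW_iff hω F k).1 hF u

end ExplicitLineJunction

end Literature.Analysis.SegalBargmann
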